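import Literature.Analysis.Complex.OneSidedPowerSumTsum
import Literature.Analysis.Complex.HarnackHalfPlane
import HarnessLib

/-!
# The one-sided power sum inequality with the constants `(8, 32)` of Kadiri–Ng–Wong
# (PAMS 147 (2019), Theorem 2.2)

Topic `Literature/Analysis/Complex`, namespace `Literature.Analysis.Complex.PowerSum` (next to
`OneSidedPowerSum.lean` / `OneSidedPowerSumTsum.lean`, the tree's PROVED Lagarias–Montgomery–Odlyzko /
Zaman / Thorner–Zaman form with constants `(12, 48 + 5ε)` resp. `(12, 96 + 10ε)`:
`exists_re_powerSum_ge`, `exists_re_tsum_powerSum_ge`). Typed for the cell `landau-siegel`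
(rung F-S3, §C literature harvest, row T-038 of `lit/HARVEST.md`; tag **detector**: the kernel
behind every explicit Deuring–Heilbronn repulsion constant in print — Thorner–Zaman 2024 Lemma 2.13
is this theorem; the tree's `ExplicitDeuringHeilbronnDirichlet.lean` / `ExplicitLogFreeZeroDensityDirichlet.lean`
consume its OUTPUT constants).

STATEMENT LAYER: ONE NAMED FACT (D-0014, `def … : Prop`, theorem-in-print),
`kadiriNgWong2019_theorem22`, DISCHARGED in this file (`kadiriNgWong2019_theorem22_holds`, the
printed proof run on the summable family), stated in exactly the shape of the tree's `exists_re_tsum_powerSum_ge`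
(an `ι`-indexed summable weighted family, `tsum`), plus PROVED bookkeeping: the Kadiri–Ng–Wong
normaliser `M_KNW = b₁⁻¹ Σ b_n|z_n|/(|z₁| + |z_n|)` is at most the LMO normaliser
`M_LMO = Σ b_n|z_n|/(b₁|z₁|)`, so the fact implies the tree's statement SHAPE with the better constants
`(8 + ε, ε/(32 + 4ε))` (`kadiriNgWong2019_theorem22.lmo_shape`).

## What the source prints (held text `paper:arxiv-1902.08640-gx02032400`, p. 4, read 2026-08-26)

H. Kadiri, N. Ng, P.-J. Wong, *The least prime ideal in the Chebotarev density theorem*,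
Proc. Amer. Math. Soc. 147 (2019) 2289–2303, doi:10.1090/proc/14384 [KadiriNgWong2019].

> **Theorem 2.2** (p0004:L5–12). Let `ε > 0`. For any `j ∈ ℕ`, set `s_j = Σ_{n ≥ 1} b_n z_nʲ`, and
> assume that (i) `z_n ∈ ℂ` and `|z_n| ≤ |z₁|` for every `n ≥ 1` where `z₁ ≠ 0`, (ii) each `b_n` is
> non-negative and `b₁ > 0`. Set `M = b₁⁻¹ Σ_{n≥1} b_n|z_n|/(|z₁| + |z_n|)`. Then there exists `j`
> with `1 ≤ j ≤ (8 + ε)M` such that `Re(s_j) ≥ (b₁ε/(32 + 4ε)) |z₁|ʲ`.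

"Remarks. (i) … thanks to Lemma 2.1 we reduce to `8` and respectively to `32` the constants `12`
and `48` appearing in [13, Theorem 2.3]" (p0004:L41–43). The proof (p0004:L14–39) is the
Lagarias–Montgomery–Odlyzko Fejér-kernel argument with ONE new input, Lemma 2.1 (iii) (p0003):
`P(r,θ) = Σ_{j=1}^J (1 − j/(J+1)) rʲ cos(jθ) ≥ −r/(1+r)` for `0 ≤ r ≤ 1`, obtained from Harnack's
inequality for the non-negative harmonic function `1 + 2P` on the unit disc.

## Lean rendering / design choices (audit notes for ls-lit-ref)

* Same shape as the tree's `exists_re_tsum_powerSum_ge`: an index type `ι`, nodes `z : ι → ℂ`,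
  weights `b : ι → ℝ` with `b ≥ 0`, the distinguished index `j₀` (the print's `n = 1`) with
  `b j₀ > 0`, `z j₀ ≠ 0`, and `‖z j‖ ≤ ‖z j₀‖` for ALL `j` (as printed; the tree's LMO form asks it
  only where `b j > 0`). The series `s_j` and `M` presuppose convergence: `Σ_n b_n|z_n| < ∞` is made
  an explicit hypothesis (`Summable`), under which every `s_j`, `j ≥ 1`, converges absolutely.
* `M = b₁⁻¹ Σ' b_n|z_n|/(|z₁| + |z_n|)` verbatim (`tsum`; the `n = 1` term contributes `½`).
* Conclusion: `∃ j : ℕ, 1 ≤ j ≤ (8+ε)M` (as a real inequality) and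
  `b₁ ε/(32+4ε) · |z₁|ʲ ≤ Re Σ' b_n z_nʲ`.
* DISCHARGE ROUTE (not taken here; recorded for a prover seat): the tree already has the Fejér
  polynomial `PowerSum.fejerPoly` with Lemma 2.1 (i) = `fejerPoly_ge_neg_half`, (ii) =
  `fejerPoly_one`, the three-term averaging `threeTerm_ge`/`exists_re_powerSum_ge`, AND Harnack's
  inequality on a disc in holomorphic clothing, `Complex.im_apply_ge_harnack`
  (`Literature/Analysis/Complex/HarnackHalfPlane.lean`). Lemma 2.1 (iii) = Harnack applied to
  `i(1 + 2Σ w_j z^j + δ)`, `δ → 0`; then the printed one-page averaging with `J = ⌊(8+ε)M⌋`.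
  Estimated M-size (≈ 300 lines, tsum bookkeeping included).

WHAT THIS IS NOT: a claim about zeros of any `L`-function; it is a statement of pure complex
analysis, vendored because the cell's B-dh/B-det designs cite its constants. «The programme
SEARCHES and TYPES; no claim about Landau–Siegel zeros, Theorems 1–2 of arXiv:2211.02515 or a
repaired Margin232 until a kernel theorem says so.»

## References

* [KadiriNgWong2019] H. Kadiri, N. Ng, P.-J. Wong, Proc. Amer. Math. Soc. 147 (2019) 2289–2303,
  arXiv:1902.08640: Lemma 2.1, Theorem 2.2, Remarks after Theorem 2.2.
* [LagariasMontgomeryOdlyzko1979] Invent. Math. 54 (1979), Theorem 4.2; [ThornerZaman2017] Algebra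
  Number Theory 11 (2017), Theorem 7.1 (tree: `OneSidedPowerSum.lean`, `OneSidedPowerSumTsum.lean`).
-/

noncomputable section

open Complex

namespace Literature.Analysis.Complex.PowerSum

/-- **The Kadiri–Ng–Wong normaliser `M = b₁⁻¹ Σ_{n≥1} b_n|z_n|/(|z₁| + |z_n|)`** of Theorem 2.2
(for a summable weighted family; the distinguished node `j₀` plays the print's `n = 1`).
[cite: KadiriNgWong2019, Theorem 2.2] -/
def knwNormaliser {ι : Type*} (z : ι → ℂ) (b : ι → ℝ) (j₀ : ι) : ℝ :=
  (b j₀)⁻¹ * ∑' j, b j * ‖z j‖ / (‖z j₀‖ + ‖z j‖)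

/-- **Kadiri–Ng–Wong 2019, Theorem 2.2** (one-sided power sum inequality, constants `(8, 32)`).
"Let `ε > 0`. For any `j ∈ ℕ`, set `s_j = Σ_{n≥1} b_n z_nʲ`, and assume that (i) `z_n ∈ ℂ` and
`|z_n| ≤ |z₁|` for every `n ≥ 1` where `z₁ ≠ 0`, (ii) each `b_n` is non-negative and `b₁ > 0`. Set
`M = b₁⁻¹ Σ_{n≥1} b_n|z_n|/(|z₁| + |z_n|)`. Then there exists `j` with `1 ≤ j ≤ (8 + ε)M` such that
`Re(s_j) ≥ (b₁ε/(32 + 4ε))|z₁|ʲ`." Rendered over an index type `ι` with distinguished index `j₀`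
(`= n = 1`), the summability `Σ b_n|z_n| < ∞` (implicit in the print's `s_j`, `M`) as an explicit
hypothesis, `M = knwNormaliser z b j₀`. It sharpens the tree's PROVED Lagarias–Montgomery–Odlyzko
form `exists_re_tsum_powerSum_ge` (`(12 + ε)M_LMO`, `ε/(96 + 10ε)`) — see
`kadiriNgWong2019_theorem22.lmo_shape`. NAMED FACT, PROVED below
(`kadiriNgWong2019_theorem22_holds`: the printed proof = the tree's Fejér-kernel argument +
Lemma 2.1 (iii) via Harnack's inequality, `fejerPoly_ge_harnack`). [cite: KadiriNgWong2019, Theorem 2.2] -/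
def kadiriNgWong2019_theorem22 : Prop :=
  ∀ {ι : Type} (z : ι → ℂ) (b : ι → ℝ), (∀ j, 0 ≤ b j) →
    Summable (fun j => b j * ‖z j‖) →
      ∀ {j₀ : ι}, 0 < b j₀ → z j₀ ≠ 0 → (∀ j, ‖z j‖ ≤ ‖z j₀‖) →
        ∀ {ε : ℝ}, 0 < ε →
          ∃ m : ℕ, 1 ≤ m ∧ (m : ℝ) ≤ (8 + ε) * knwNormaliser z b j₀ ∧
            b j₀ * ε / (32 + 4 * ε) * ‖z j₀‖ ^ m ≤ (∑' j, (b j : ℂ) * z j ^ m).re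

/-! ### Bookkeeping (proved) -/

/-- The Kadiri–Ng–Wong normaliser is at most the Lagarias–Montgomery–Odlyzko normaliser
`M_LMO = Σ b_n|z_n|/(b₁|z₁|)`: termwise `|z_n|/(|z₁| + |z_n|) ≤ |z_n|/|z₁|`.
[cite: KadiriNgWong2019, Theorem 2.2 (Remarks (i))] -/
theorem knwNormaliser_le {ι : Type*} (z : ι → ℂ) (b : ι → ℝ) (hb : ∀ j, 0 ≤ b j)
    (hsum : Summable (fun j => b j * ‖z j‖)) {j₀ : ι} (hb₀ : 0 < b j₀) (hz₀ : z j₀ ≠ 0) :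
    knwNormaliser z b j₀ ≤ (∑' j, b j * ‖z j‖) / (b j₀ * ‖z j₀‖) := by
  have hR : 0 < ‖z j₀‖ := norm_pos_iff.mpr hz₀
  unfold knwNormaliser
  -- termwise comparison `b|z|/(|z₀| + |z|) ≤ b|z|/|z₀|`
  have hterm : ∀ j, b j * ‖z j‖ / (‖z j₀‖ + ‖z j‖) ≤ b j * ‖z j‖ / ‖z j₀‖ := fun j =>
    div_le_div_of_nonneg_left (mul_nonneg (hb j) (norm_nonneg _)) hR
      (le_add_of_nonneg_right (norm_nonneg _))
  have hnn : ∀ j, 0 ≤ b j * ‖z j‖ / (‖z j₀‖ + ‖z j‖) := fun j => by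
    have := hb j; positivity
  have hsum' : Summable (fun j => b j * ‖z j‖ / ‖z j₀‖) := hsum.div_const _
  have hsum'' : Summable (fun j => b j * ‖z j‖ / (‖z j₀‖ + ‖z j‖)) :=
    Summable.of_nonneg_of_le hnn hterm hsum'
  have hle : ∑' j, b j * ‖z j‖ / (‖z j₀‖ + ‖z j‖) ≤ ∑' j, b j * ‖z j‖ / ‖z j₀‖ :=
    hsum''.tsum_le_tsum hterm hsum'
  rw [tsum_div_const] at hle
  calc (b j₀)⁻¹ * ∑' j, b j * ‖z j‖ / (‖z j₀‖ + ‖z j‖)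
      ≤ (b j₀)⁻¹ * ((∑' j, b j * ‖z j‖) / ‖z j₀‖) :=
        mul_le_mul_of_nonneg_left hle (inv_nonneg.mpr hb₀.le)
    _ = (∑' j, b j * ‖z j‖) / (b j₀ * ‖z j₀‖) := by
        field_simp

/-- **Theorem 2.2 in the tree's LMO shape, with the better constants**: modulo the fact, some
`m ∈ ℕ` with `1 ≤ m ≤ (8 + ε)·Σ b_n|z_n|/(b₁|z₁|)` has `Re Σ b_n z_nᵐ ≥ (ε/(32 + 4ε)) b₁|z₁|ᵐ`
(compare `exists_re_tsum_powerSum_ge`: `(12 + ε)`, `ε/(96 + 10ε)`).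
[cite: KadiriNgWong2019, Theorem 2.2 (Remarks (i))] -/
theorem kadiriNgWong2019_theorem22.lmo_shape (h : kadiriNgWong2019_theorem22) {ι : Type}
    (z : ι → ℂ) (b : ι → ℝ) (hb : ∀ j, 0 ≤ b j) (hsum : Summable (fun j => b j * ‖z j‖))
    {j₀ : ι} (hb₀ : 0 < b j₀) (hz₀ : z j₀ ≠ 0) (hmax : ∀ j, ‖z j‖ ≤ ‖z j₀‖) {ε : ℝ} (hε : 0 < ε) :
    ∃ m : ℕ, 1 ≤ m ∧ (m : ℝ) ≤ (8 + ε) * ((∑' j, b j * ‖z j‖) / (b j₀ * ‖z j₀‖)) ∧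
      ε / (32 + 4 * ε) * b j₀ * ‖z j₀‖ ^ m ≤ (∑' j, (b j : ℂ) * z j ^ m).re := by
  obtain ⟨m, hm1, hmM, hre⟩ := h z b hb hsum hb₀ hz₀ hmax hε
  refine ⟨m, hm1, hmM.trans ?_, ?_⟩
  · exact mul_le_mul_of_nonneg_left (knwNormaliser_le z b hb hsum hb₀ hz₀) (by linarith)
  · calc ε / (32 + 4 * ε) * b j₀ * ‖z j₀‖ ^ m = b j₀ * ε / (32 + 4 * ε) * ‖z j₀‖ ^ m := by ring
      _ ≤ _ := hre


/-! ### Discharge of Theorem 2.2 (Kadiri–Ng–Wong's own argument, run on the summable family)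

The printed proof (§2.1, p. 4) verbatim: normalise `|z₁| = 1`; with the Fejér weights
`w_j = 1 − j/(J+1)` and `P = P_J` (`fejerPoly`), the average
`S = Σ_{j≤J} w_j Re(s_j)(1 + cos jθ₁)` equals `Σ_n b_n (P(z_n) + ½P(z_n z₁) + ½P(z_n z̄₁))` (2.2); the
`n = 1` term is `≥ b₁((J+1)/4 − 2·½)` (Lemma 2.1 (ii),(iii)), the others `≥ −2 b_n r_n/(1+r_n)`
(Lemma 2.1 (iii): `P(r,θ) ≥ −r/(1+r)`, Harnack), so `S ≥ b₁((J+1)/4 − 2M) ≥ b₁εM/4` for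
`J = ⌊(8+ε)M⌋`, while `S ≤ J · max_j Re s_j`. Lemma 2.1 (iii) is `fejerPoly_ge_harnack` (Harnack's
inequality `Complex.im_apply_ge_harnack` of `HarnackHalfPlane.lean` applied to
`i(1 + δ + 2p_J)`, `δ ↓ 0`); the rest mirrors the tree's Finset proof `exists_re_powerSum_ge`
(`OneSidedPowerSum.lean`) with `tsum`s, WITHOUT truncation (so the printed constants `8`, `32` are
reached, unlike the factor-2 loss of `OneSidedPowerSumTsum.lean`). -/

/-- **Lemma 2.1 (iii)** (Kadiri–Ng–Wong): `P_J(z) ≥ −|z|/(1 + |z|)` for `|z| ≤ 1` — Harnack's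
inequality for the non-negative harmonic function `1 + 2P_J` on the unit disc (value `1` at the
centre). [cite: KadiriNgWong2019, Lemma 2.1 (iii)] -/
theorem fejerPoly_ge_harnack (J : ℕ) {z : ℂ} (hz : ‖z‖ ≤ 1) :
    -(‖z‖ / (1 + ‖z‖)) ≤ fejerPoly J z := by
  rcases hz.lt_or_eq with hlt | heq
  swap
  · have h := fejerPoly_ge_neg_half J hz
    rw [heq]
    norm_num at h ⊢
    exact h
  set p : ℂ → ℂ := fun w ↦ ∑ j ∈ Finset.range J,
    ((1 - ((j : ℝ) + 1) / ((J : ℝ) + 1) : ℝ) : ℂ) * w ^ (j + 1) with hp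
  have hre : ∀ w : ℂ, (p w).re = fejerPoly J w := by
    intro w
    rw [hp]; dsimp only
    rw [Complex.re_sum, fejerPoly]
    refine Finset.sum_congr rfl fun j _ ↦ ?_
    rw [Complex.re_ofReal_mul]
  have hP0 : fejerPoly J 0 = 0 := by
    simp [fejerPoly]
  have hr0 : 0 ≤ (1 - ‖z‖) / (1 + ‖z‖) := div_nonneg (by linarith) (by positivity)
  suffices h : ∀ δ : ℝ, 0 < δ → (1 - ‖z‖) / (1 + ‖z‖) ≤ 1 + 2 * fejerPoly J z + δ by
    have h1 : (1 - ‖z‖) / (1 + ‖z‖) ≤ 1 + 2 * fejerPoly J z := le_of_forall_pos_le_add h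
    have h2 : (1 - ‖z‖) / (1 + ‖z‖) = 1 - 2 * (‖z‖ / (1 + ‖z‖)) := by
      field_simp
      ring
    rw [h2] at h1
    linarith
  intro δ hδ
  set Q : ℂ → ℂ := fun w ↦ I * (((1 + δ : ℝ) : ℂ) + ((2 : ℝ) : ℂ) * p w) with hQ
  have hQim : ∀ w, (Q w).im = 1 + δ + 2 * fejerPoly J w := by
    intro w
    rw [hQ]; dsimp only
    rw [Complex.I_mul_im, Complex.add_re, Complex.ofReal_re, Complex.re_ofReal_mul, hre]
  have hd : DifferentiableOn ℂ Q (Metric.ball 0 1) := by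
    have : Differentiable ℂ Q := by
      rw [hQ, hp]
      fun_prop
    exact this.differentiableOn
  have hpos : ∀ w ∈ Metric.ball (0 : ℂ) 1, 0 < (Q w).im := by
    intro w hw
    rw [hQim]
    have hw1 : ‖w‖ ≤ 1 := (mem_ball_zero_iff.mp hw).le
    have := fejerPoly_ge_neg_half J hw1
    linarith
  have hzb : z ∈ Metric.ball (0 : ℂ) 1 := mem_ball_zero_iff.mpr hlt
  have key := Complex.im_apply_ge_harnack one_pos hd hpos hzb
  rw [hQim, hQim, hP0, sub_zero] at key
  have h3 : (1 - ‖z‖) / (1 + ‖z‖) ≤ (1 + δ + 2 * 0) * ((1 - ‖z‖) / (1 + ‖z‖)) := by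
    nlinarith
  linarith

/-- The three-term kernel bound for a general node, Harnack form: for `|u| ≤ 1`, `|u₀| = 1`,
`P(u) + ½P(u u₀) + ½P(u ū₀) ≥ −2|u|/(1 + |u|)` ((2.4) of the printed proof).
[cite: KadiriNgWong2019, Theorem 2.2 (proof, (2.4))] -/
theorem threeTerm_ge_harnack (J : ℕ) {u u₀ : ℂ} (hu : ‖u‖ ≤ 1) (hu₀ : ‖u₀‖ = 1) :
    -(2 * (‖u‖ / (1 + ‖u‖))) ≤
      fejerPoly J u + 1 / 2 * fejerPoly J (u * u₀) + 1 / 2 * fejerPoly J (u * (starRingEnd ℂ) u₀) := by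
  have hn1 : ‖u * u₀‖ = ‖u‖ := by rw [norm_mul, hu₀, mul_one]
  have hn2 : ‖u * (starRingEnd ℂ) u₀‖ = ‖u‖ := by rw [norm_mul, Complex.norm_conj, hu₀, mul_one]
  have e1 := fejerPoly_ge_harnack J hu
  have e2 := fejerPoly_ge_harnack J (show ‖u * u₀‖ ≤ 1 by rw [hn1]; exact hu)
  have e3 := fejerPoly_ge_harnack J (show ‖u * (starRingEnd ℂ) u₀‖ ≤ 1 by rw [hn2]; exact hu)
  rw [hn1] at e2
  rw [hn2] at e3
  linarith

set_option maxHeartbeats 800000 in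
/-- **Kadiri–Ng–Wong 2019, Theorem 2.2 — PROVED** (discharge of the named fact
`kadiriNgWong2019_theorem22`, following the printed proof on the summable family).
[cite: KadiriNgWong2019, Theorem 2.2] -/
theorem kadiriNgWong2019_theorem22_holds : kadiriNgWong2019_theorem22 := by
  intro ι z b hb hsum j₀ hb₀ hz₀ hmax ε hε
  classical
  -- normalisation `u_j = z_j / |z_{j₀}|`
  set R : ℝ := ‖z j₀‖ with hR
  have hR0 : 0 < R := norm_pos_iff.mpr hz₀
  have hRc : (R : ℂ) ≠ 0 := by exact_mod_cast hR0.ne'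
  set u : ι → ℂ := fun j ↦ z j / R with hu
  have hnu : ∀ j, ‖u j‖ = ‖z j‖ / R := by
    intro j
    rw [hu]; dsimp only
    rw [norm_div, Complex.norm_real, Real.norm_of_nonneg hR0.le]
  have hu1 : ∀ j, ‖u j‖ ≤ 1 := by
    intro j
    rw [hnu, div_le_one hR0]
    exact hmax j
  have hu₀ : ‖u j₀‖ = 1 := by
    rw [hnu, ← hR, div_self hR0.ne']
  have hzu : ∀ j (m : ℕ), z j ^ m = (R : ℂ) ^ m * u j ^ m := by
    intro j m
    rw [hu]; dsimp only
    rw [div_pow, mul_div_cancel₀ _ (pow_ne_zero _ hRc)]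
  -- the weights `g_j = |u_j|/(1+|u_j|) = |z_j|/(|z_{j₀}| + |z_j|)` and the normaliser `L`
  set g : ι → ℝ := fun j ↦ ‖u j‖ / (1 + ‖u j‖) with hg
  have hg_eq : ∀ j, b j * ‖z j‖ / (‖z j₀‖ + ‖z j‖) = b j * g j := by
    intro j
    rw [hg]; dsimp only
    rw [hnu j, ← hR]
    have h1 : 0 < R + ‖z j‖ := by positivity
    field_simp
  have hg_nn : ∀ j, 0 ≤ b j * g j := fun j ↦ mul_nonneg (hb j) (by positivity)
  have hg_le : ∀ j, b j * g j ≤ b j * ‖u j‖ := by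
    intro j
    refine mul_le_mul_of_nonneg_left ?_ (hb j)
    rw [hg]; dsimp only
    rw [div_le_iff₀ (by positivity)]
    nlinarith [norm_nonneg (u j)]
  have hsu : Summable fun j ↦ b j * ‖u j‖ := by
    have : (fun j ↦ b j * ‖u j‖) = fun j ↦ b j * ‖z j‖ * R⁻¹ := by
      funext j
      rw [hnu]
      ring
    rw [this]
    exact hsum.mul_right _
  have hsg : Summable fun j ↦ b j * g j := Summable.of_nonneg_of_le hg_nn hg_le hsu
  set L : ℝ := knwNormaliser z b j₀ with hL
  have hLb : L * b j₀ = ∑' j, b j * g j := by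
    rw [hL, knwNormaliser, tsum_congr hg_eq]
    field_simp
  have hg₀ : g j₀ = 1 / 2 := by
    rw [hg]; dsimp only
    rw [hu₀]
    norm_num
  have hL_half : b j₀ / 2 ≤ L * b j₀ := by
    rw [hLb]
    have h1 : b j₀ * g j₀ ≤ ∑' j, b j * g j := hsg.le_tsum j₀ fun j _ ↦ hg_nn j
    rw [hg₀] at h1
    linarith
  have hL0 : 0 < L := by
    by_contra h
    push Not at h
    nlinarith
  -- `J = ⌊(8+ε)L⌋`, `c = ε/(32+4ε)`
  set J : ℕ := ⌊(8 + ε) * L⌋₊ with hJ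
  have hJle : (J : ℝ) ≤ (8 + ε) * L := Nat.floor_le (by positivity)
  have hJgt : (8 + ε) * L < J + 1 := Nat.lt_floor_add_one _
  set c : ℝ := ε / (32 + 4 * ε) with hc
  have hc0 : 0 < c := by positivity
  have hc' : b j₀ * ε / (32 + 4 * ε) = c * b j₀ := by
    rw [hc]
    ring
  -- summability of the normalised power sums
  have hsk : ∀ k : ℕ, Summable fun j ↦ (b j : ℂ) * u j ^ (k + 1) := by
    intro k
    refine hsu.of_norm_bounded fun j ↦ ?_
    rw [norm_mul, Complex.norm_real, Real.norm_of_nonneg (hb j), norm_pow]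
    exact mul_le_mul_of_nonneg_left
      (pow_le_of_le_one (norm_nonneg _) (hu1 j) (Nat.succ_ne_zero k)) (hb j)
  -- suppose the conclusion fails for every `m ≤ (8+ε)L`
  by_contra hcon
  push Not at hcon
  have hsmall : ∀ k ∈ Finset.range J, (∑' j, (b j : ℂ) * u j ^ (k + 1)).re < c * b j₀ := by
    intro k hk
    have hk' : k + 1 ≤ J := Finset.mem_range.mp hk
    have h := hcon (k + 1) (by omega)
      ((show ((k + 1 : ℕ) : ℝ) ≤ J by exact_mod_cast hk').trans hJle)
    have e : (∑' j, (b j : ℂ) * z j ^ (k + 1)) =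
        ((R ^ (k + 1) : ℝ) : ℂ) * ∑' j, (b j : ℂ) * u j ^ (k + 1) := by
      rw [← tsum_mul_left]
      refine tsum_congr fun j ↦ ?_
      rw [hzu j (k + 1)]
      push_cast
      ring
    rw [e, Complex.re_ofReal_mul, hc'] at h
    have hRm : 0 < R ^ (k + 1) := pow_pos hR0 _
    by_contra hge
    push Not at hge
    have := mul_le_mul_of_nonneg_left hge hRm.le
    linarith
  -- the weighted average `S`
  set w : ℕ → ℝ := fun k ↦ 1 - ((k : ℝ) + 1) / ((J : ℝ) + 1) with hw
  set S : ℝ := ∑ k ∈ Finset.range J,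
    w k * (∑' j, (b j : ℂ) * u j ^ (k + 1)).re * (1 + (u j₀ ^ (k + 1)).re) with hSdef
  -- the kernel `T_j = P(u_j) + ½P(u_j u₀) + ½P(u_j ū₀)` and the summands `f k j`
  set T : ι → ℝ := fun j ↦ fejerPoly J (u j) + 1 / 2 * fejerPoly J (u j * u j₀) +
    1 / 2 * fejerPoly J (u j * (starRingEnd ℂ) (u j₀)) with hT
  set f : ℕ → ι → ℝ := fun k j ↦ b j * (w k * ((u j ^ (k + 1)).re +
    1 / 2 * ((u j * u j₀) ^ (k + 1)).re + 1 / 2 * ((u j * (starRingEnd ℂ) (u j₀)) ^ (k + 1)).re))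
    with hf
  have hw01 : ∀ k ∈ Finset.range J, 0 ≤ w k ∧ w k ≤ 1 := fun k hk ↦
    ⟨fejerWeight_nonneg (Finset.mem_range.mp hk), fejerWeight_le_one J k⟩
  have hre_le : ∀ (v : ℂ) (k : ℕ), ‖v‖ ≤ 1 → |(v ^ (k + 1)).re| ≤ ‖v‖ := by
    intro v k hv
    refine (Complex.abs_re_le_norm _).trans ?_
    rw [norm_pow]
    exact pow_le_of_le_one (norm_nonneg _) hv (Nat.succ_ne_zero k)
  have hfs : ∀ k ∈ Finset.range J, Summable (f k) := by
    intro k hk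
    have hn1 : ∀ j, ‖u j * u j₀‖ = ‖u j‖ := fun j ↦ by rw [norm_mul, hu₀, mul_one]
    have hn2 : ∀ j, ‖u j * (starRingEnd ℂ) (u j₀)‖ = ‖u j‖ := fun j ↦ by
      rw [norm_mul, Complex.norm_conj, hu₀, mul_one]
    refine (hsu.mul_left 2).of_norm_bounded fun j ↦ ?_
    rw [hf]; dsimp only
    rw [Real.norm_eq_abs, abs_mul, abs_of_nonneg (hb j)]
    have h1 := hre_le (u j) k (hu1 j)
    have h2 := hre_le (u j * u j₀) k (by rw [hn1]; exact hu1 j)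
    have h3 := hre_le (u j * (starRingEnd ℂ) (u j₀)) k (by rw [hn2]; exact hu1 j)
    rw [hn1] at h2
    rw [hn2] at h3
    have hwk := hw01 k hk
    have h4 : |w k * ((u j ^ (k + 1)).re + 1 / 2 * ((u j * u j₀) ^ (k + 1)).re +
        1 / 2 * ((u j * (starRingEnd ℂ) (u j₀)) ^ (k + 1)).re)| ≤ 2 * ‖u j‖ := by
      rw [abs_mul, abs_of_nonneg hwk.1]
      have h5 : |(u j ^ (k + 1)).re + 1 / 2 * ((u j * u j₀) ^ (k + 1)).re +
          1 / 2 * ((u j * (starRingEnd ℂ) (u j₀)) ^ (k + 1)).re| ≤ 2 * ‖u j‖ := by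
        have a1 := abs_add_le ((u j ^ (k + 1)).re + 1 / 2 * ((u j * u j₀) ^ (k + 1)).re)
          (1 / 2 * ((u j * (starRingEnd ℂ) (u j₀)) ^ (k + 1)).re)
        have a2 := abs_add_le ((u j ^ (k + 1)).re) (1 / 2 * ((u j * u j₀) ^ (k + 1)).re)
        have a3 : |1 / 2 * ((u j * u j₀) ^ (k + 1)).re| = 1 / 2 * |((u j * u j₀) ^ (k + 1)).re| := by
          rw [abs_mul, abs_of_pos (by norm_num : (0 : ℝ) < 1 / 2)]
        have a4 : |1 / 2 * ((u j * (starRingEnd ℂ) (u j₀)) ^ (k + 1)).re| =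
            1 / 2 * |((u j * (starRingEnd ℂ) (u j₀)) ^ (k + 1)).re| := by
          rw [abs_mul, abs_of_pos (by norm_num : (0 : ℝ) < 1 / 2)]
        linarith
      calc w k * |_| ≤ 1 * (2 * ‖u j‖) :=
            mul_le_mul hwk.2 h5 (abs_nonneg _) zero_le_one
        _ = 2 * ‖u j‖ := one_mul _
    calc b j * |_| ≤ b j * (2 * ‖u j‖) := mul_le_mul_of_nonneg_left h4 (hb j)
      _ = 2 * (b j * ‖u j‖) := by ring
  -- (1) `S = Σ' b_j T_j`
  have hS_k : ∀ k ∈ Finset.range J,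
      w k * (∑' j, (b j : ℂ) * u j ^ (k + 1)).re * (1 + (u j₀ ^ (k + 1)).re) = ∑' j, f k j := by
    intro k _
    rw [Complex.re_tsum (hsk k)]
    have e1 : (∑' j, ((b j : ℂ) * u j ^ (k + 1)).re) = ∑' j, b j * (u j ^ (k + 1)).re :=
      tsum_congr fun j ↦ by rw [Complex.re_ofReal_mul]
    rw [e1, mul_comm (w k), mul_assoc, ← tsum_mul_right]
    refine tsum_congr fun j ↦ ?_
    rw [hf]; dsimp only
    have h2 := re_mul_re_eq (u j ^ (k + 1)) (u j₀ ^ (k + 1))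
    rw [← mul_pow, map_pow, ← mul_pow] at h2
    have h3 : (u j ^ (k + 1)).re * (1 + (u j₀ ^ (k + 1)).re) =
        (u j ^ (k + 1)).re + 1 / 2 * ((u j * u j₀) ^ (k + 1)).re +
          1 / 2 * ((u j * (starRingEnd ℂ) (u j₀)) ^ (k + 1)).re := by
      rw [mul_add, mul_one, h2]
      ring
    calc b j * (u j ^ (k + 1)).re * (w k * (1 + (u j₀ ^ (k + 1)).re))
        = b j * (w k * ((u j ^ (k + 1)).re * (1 + (u j₀ ^ (k + 1)).re))) := by ring
      _ = _ := by rw [h3]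
  have hf_sum : ∀ j, ∑ k ∈ Finset.range J, f k j = b j * T j := by
    intro j
    rw [hf, hT]; dsimp only
    rw [← Finset.mul_sum]
    congr 1
    simp only [fejerPoly, hw]
    rw [Finset.mul_sum, Finset.mul_sum, ← Finset.sum_add_distrib, ← Finset.sum_add_distrib]
    refine Finset.sum_congr rfl fun k _ ↦ ?_
    ring
  have hTs : Summable fun j ↦ b j * T j := by
    have := summable_sum hfs
    simp only [hf_sum] at this
    exact this
  have hS_eq : S = ∑' j, b j * T j := by
    rw [hSdef, Finset.sum_congr rfl hS_k, ← Summable.tsum_finsetSum hfs]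
    exact tsum_congr hf_sum
  -- (2) the lower bound `S ≥ b₀((J+1)/4 − 2L)`
  have hS_ge : b j₀ * (((J : ℝ) + 1) / 4) - 2 * (L * b j₀) ≤ S := by
    have hpt : ∀ j, 0 ≤ b j * (T j + 2 * g j) := by
      intro j
      refine mul_nonneg (hb j) ?_
      have := threeTerm_ge_harnack J (hu1 j) hu₀
      rw [hT, hg]; dsimp only
      linarith
    have htop : b j₀ * (((J : ℝ) + 1) / 4) ≤ b j₀ * (T j₀ + 2 * g j₀) := by
      refine mul_le_mul_of_nonneg_left ?_ hb₀.le
      have := threeTerm_top_ge J hu₀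
      rw [hT, hg₀]; dsimp only
      linarith
    have hs2 : Summable fun j ↦ b j * (T j + 2 * g j) := by
      have : (fun j ↦ b j * (T j + 2 * g j)) = fun j ↦ b j * T j + 2 * (b j * g j) := by
        funext j; ring
      rw [this]
      exact hTs.add (hsg.mul_left 2)
    have h1 : b j₀ * (T j₀ + 2 * g j₀) ≤ ∑' j, b j * (T j + 2 * g j) :=
      hs2.le_tsum j₀ fun j _ ↦ hpt j
    have h2 : ∑' j, b j * (T j + 2 * g j) = S + 2 * (L * b j₀) := by
      rw [hS_eq, hLb, ← tsum_mul_left, ← hTs.tsum_add (hsg.mul_left 2)]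
      exact tsum_congr fun j ↦ by ring
    linarith
  -- (3) the upper bound `S ≤ c b₀ J`
  have hS_le : S ≤ c * b j₀ * J := by
    have hterm : ∀ k ∈ Finset.range J,
        w k * (∑' j, (b j : ℂ) * u j ^ (k + 1)).re * (1 + (u j₀ ^ (k + 1)).re) ≤
          c * b j₀ * (w k * (1 + (u j₀ ^ (k + 1)).re)) := by
      intro k hk
      have hwk : 0 ≤ w k := (hw01 k hk).1
      have hpos : 0 ≤ 1 + (u j₀ ^ (k + 1)).re := by
        have h1 := hre_le (u j₀) k hu₀.le
        rw [hu₀] at h1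
        have := neg_abs_le (u j₀ ^ (k + 1)).re
        linarith
      have h := hsmall k hk
      have := mul_le_mul_of_nonneg_left h.le (mul_nonneg hwk hpos)
      nlinarith
    refine (Finset.sum_le_sum hterm).trans ?_
    rw [← Finset.mul_sum]
    have hsum' : ∑ k ∈ Finset.range J, w k * (1 + (u j₀ ^ (k + 1)).re) =
        (J : ℝ) / 2 + fejerPoly J (u j₀) := by
      rw [fejerPoly, ← sum_fejerWeight J, ← Finset.sum_add_distrib]
      refine Finset.sum_congr rfl fun k _ ↦ ?_
      simp only [hw]
      ring
    rw [hsum']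
    have hP := fejerPoly_le J hu₀.le
    have : (J : ℝ) / 2 + fejerPoly J (u j₀) ≤ J := by linarith
    exact mul_le_mul_of_nonneg_left this (by positivity)
  -- (4) contradiction: `c J ≤ c(8+ε)L = εL/4 < (J+1)/4 − 2L`
  have h1 : c * ((8 + ε) * L) = ε * L / 4 := by
    rw [hc]
    field_simp
    ring
  have h2 : c * b j₀ * J ≤ b j₀ * (ε * L / 4) := by
    have := mul_le_mul_of_nonneg_left hJle hc0.le
    rw [h1] at this
    have := mul_le_mul_of_nonneg_left this hb₀.le
    linarith
  have h3 : b j₀ * (ε * L / 4) < b j₀ * (((J : ℝ) + 1) / 4) - 2 * (L * b j₀) := by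
    have key : ε * L / 4 < ((J : ℝ) + 1) / 4 - 2 * L := by linarith
    have := mul_lt_mul_of_pos_left key hb₀
    linarith
  linarith

end Literature.Analysis.Complex.PowerSum

end
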